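import Literature.Probability.RandomPlanarGeometry.SAWTriangularDetourSurgery
import Literature.Probability.RandomPlanarGeometry.SAWUnfoldingStep
import Literature.Probability.Percolation.BrickHex
import HarnessLib

/-!
# Self-avoiding walks of the triangular lattice in brick coordinates (vertex-function model)

Topic `Literature/Probability/RandomPlanarGeometry` (lane «pcv-sawmu», door C2 «TRI-HW»: the
Hammersley–Welsh bound `c_N(𝕋) ≤ e^{K√N} μ(𝕋)^N` on the triangular lattice). Sources: G. Grimmett,
*Probability on Graphs* (2nd ed. 2018), §5.5 (the "brick wall" picture of `𝕋`: integer coordinates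
`(X, Y) = (2x₀ + x₁, x₁)`, neighbours `(X ± 2, Y)` and `(X ± 1, Y ± 1)`; the tree's `brickX`,
`triGraph_adj_iff_brick`, `triReflEquiv` of `BrickHex.lean`); N. Madras, G. Slade, *The Self-Avoiding Walk*
(1993), §1.1–§1.2 and §3.1 (walks as vertex functions; bridges and half-space walks by the FIRST
coordinate; the Hammersley–Welsh unfolding by reflection in a hyperplane `x₁ = A`).

## Why brick coordinates

The tree's Hammersley–Welsh machinery for `ℤ^d` (`SAWBridges`, `SAWUnfoldingStep`, `SAWUnfolding`,
`HammersleyWelshBound`) is written for vertex functions `ω : ℕ → Site d` and the height `ω i 0`; its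
DEFINITIONS (`Zd.IsBridge`, `Zd.IsHalfSpace`, `Zd.concatWalk`, `Zd.lastMin`, `Zd.tailWalk`, `Zd.reflCoord`,
`Zd.maxLevel`, `Zd.lastArgmax`, `Zd.unfoldStep`, …) and all their graph-free lemmas apply verbatim to ANY
walk model on `Site d` whose height is coordinate `0`. In brick coordinates the triangular lattice is the
graph `brickGraph` on `Site 2 = ℤ²` with steps `(±2, 0)`, `(±1, ±1)`: the height `X` IS coordinate `0`,
every step changes it by `1` or `2` (never `0`), translations and the reflection `X ↦ 2A − X` of
coordinate `0` (`Zd.reflCoord A`) are automorphisms. So the `ℤ^d` files port to `𝕋` by re-proving only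
their model-dependent statements (membership in the walk finsets), which is what this file and its
sequels do.

## Contents (namespace `Literature.Probability.RandomPlanarGeometry.SAW`)

* `brickGraph` — the brick-wall graph on `ℤ²`; `brickGraph_adj_add_right/_sub_right` (translations),
  `brickGraph_adj_reflCoord` (reflection of coordinate `0`), `apply_zero_ne_of_adj`,
  `abs_sub_apply_zero_le_two`, `abs_sub_apply_one_le_one` (step sizes);
* `toBrick x = (2x₀ + x₁, x₁)` (injective, additive) with `brickGraph_adj_toBrick : toBrick x ~ toBrick y ↔ x ~_𝕋 y`
  (= the tree's `triGraph_adj_iff_brick`), `fromBrick`, and the parity invariant of `brickGraph`;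
* `brickSaws n : Finset (ℕ → Site 2)` — the `n`-step self-avoiding walks of `𝕋` from `0` read in brick
  coordinates as vertex functions frozen after time `n` (the image of the tree's list model `triSL n`),
  with the membership characterisation `mem_brickSaws` (start `0`, `n` steps of `brickGraph`, frozen,
  injective on `[0, n]` — the exact analogue of `Zd.mem_saws`) and **`card_brickSaws : #(brickSaws n) = c_n(𝕋)`**;
* `abs_apply_zero_le_of_mem_brickSaws` — after `i` steps the height is at most `2i` in absolute value.
-/

noncomputable section

open Finset Function Literature.Probability.LatticeModels Literature.Probability.Percolation SimpleGraph

namespace Literature.Probability.RandomPlanarGeometry.SAW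

/-! ### The brick-wall graph -/

/-- **The brick-wall graph**: `ℤ²` with `u ~ w` iff `(w − u) ∈ {(±2, 0), (±1, ±1)}` — the triangular
lattice in the integer coordinates `(X, Y) = (2x₀ + x₁, x₁)` (on the sublattice `X ≡ Y (mod 2)`; the
other coset is a second copy). [cite: Grimmett2018, §5.5] -/
def brickGraph : SimpleGraph (Site 2) where
  Adj u w := (w 1 = u 1 ∧ (w 0 = u 0 + 2 ∨ w 0 + 2 = u 0)) ∨
    ((w 1 = u 1 + 1 ∨ w 1 + 1 = u 1) ∧ (w 0 = u 0 + 1 ∨ w 0 + 1 = u 0))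
  symm := ⟨fun u w h => by omega⟩
  loopless := ⟨fun u h => by omega⟩

/-- Adjacency of the brick-wall graph, unfolded. [cite: Grimmett2018, §5.5] -/
theorem brickGraph_adj_iff (u w : Site 2) :
    brickGraph.Adj u w ↔ (w 1 = u 1 ∧ (w 0 = u 0 + 2 ∨ w 0 + 2 = u 0)) ∨
      ((w 1 = u 1 + 1 ∨ w 1 + 1 = u 1) ∧ (w 0 = u 0 + 1 ∨ w 0 + 1 = u 0)) :=
  Iff.rfl

/-- Adjacency of the brick-wall graph is decidable. [cite: Grimmett2018, §5.5] -/
instance : DecidableRel brickGraph.Adj := fun u w =>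
  decidable_of_iff _ (brickGraph_adj_iff u w).symm

/-- Translation invariance of the brick-wall graph. [cite: Grimmett2018, §5.5] -/
theorem brickGraph_adj_add_right (u w v : Site 2) :
    brickGraph.Adj (u + v) (w + v) ↔ brickGraph.Adj u w := by
  simp only [brickGraph_adj_iff, Pi.add_apply]
  omega

/-- Translation invariance of the brick-wall graph. [cite: Grimmett2018, §5.5] -/
theorem brickGraph_adj_sub_right (u w v : Site 2) :
    brickGraph.Adj (u - v) (w - v) ↔ brickGraph.Adj u w := by
  simp only [brickGraph_adj_iff, Pi.sub_apply]
  omega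

/-- The reflection `X ↦ 2ℓ − X` of the height (coordinate `0`) is an automorphism of the brick-wall
graph (it is the tree's `triReflIso`, the mirror `(a, b) ↦ (c − a − b, b)` of `𝕋`, read in brick
coordinates). [cite: Grimmett2018, Lemma 5.20 (proof)] -/
theorem brickGraph_adj_reflCoord (ℓ : ℤ) {u w : Site 2} (h : brickGraph.Adj u w) :
    brickGraph.Adj (Zd.reflCoord ℓ u) (Zd.reflCoord ℓ w) := by
  have h1 : (1 : Fin 2) ≠ 0 := by decide
  simp only [brickGraph_adj_iff, Zd.reflCoord_apply_zero, Zd.reflCoord_apply_of_ne _ _ h1] at h ⊢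
  omega

/-- Every step of the brick-wall graph changes the height: `u₀ ≠ w₀`. [cite: Grimmett2018, §5.5] -/
theorem apply_zero_ne_of_adj {u w : Site 2} (h : brickGraph.Adj u w) : u 0 ≠ w 0 := by
  rw [brickGraph_adj_iff] at h
  omega

/-- A step changes the height by at most `2`. [cite: Grimmett2018, §5.5] -/
theorem abs_sub_apply_zero_le_two {u w : Site 2} (h : brickGraph.Adj u w) : |w 0 - u 0| ≤ 2 := by
  rw [brickGraph_adj_iff] at h
  rw [abs_le]
  omega

/-- A step changes the row by at most `1`. [cite: Grimmett2018, §5.5] -/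
theorem abs_sub_apply_one_le_one {u w : Site 2} (h : brickGraph.Adj u w) : |w 1 - u 1| ≤ 1 := by
  rw [brickGraph_adj_iff] at h
  rw [abs_le]
  omega

/-- The parity `X + Y (mod 2)` is constant along edges of the brick-wall graph. [cite: Grimmett2018, §5.5] -/
theorem even_add_iff_of_adj {u w : Site 2} (h : brickGraph.Adj u w) :
    Even (u 0 + u 1) ↔ Even (w 0 + w 1) := by
  rw [brickGraph_adj_iff] at h
  simp only [Int.even_iff]
  omega

/-! ### Brick coordinates of a site of `𝕋` -/

/-- The brick coordinates `(X, Y) = (2x₀ + x₁, x₁)` of a site `x` of `𝕋` (`X = brickX x`).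
[cite: Grimmett2018, §5.5] -/
def toBrick (x : Site 2) : Site 2 := fun i => if i = 0 then 2 * x 0 + x 1 else x 1

/-- First brick coordinate. [cite: Grimmett2018, §5.5] -/
@[simp] theorem toBrick_apply_zero (x : Site 2) : toBrick x 0 = 2 * x 0 + x 1 := rfl

/-- Second brick coordinate. [cite: Grimmett2018, §5.5] -/
@[simp] theorem toBrick_apply_one (x : Site 2) : toBrick x 1 = x 1 := rfl

/-- `toBrick x 0 = brickX x`. [cite: Grimmett2018, §5.5] -/
theorem toBrick_apply_zero_eq_brickX (x : Site 2) : toBrick x 0 = brickX x := rfl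

/-- `toBrick 0 = 0`. [cite: Grimmett2018, §5.5] -/
@[simp] theorem toBrick_zero : toBrick (0 : Site 2) = 0 := by
  funext i
  fin_cases i <;> simp [toBrick]

/-- `toBrick` is additive. [cite: Grimmett2018, §5.5] -/
theorem toBrick_add (x y : Site 2) : toBrick (x + y) = toBrick x + toBrick y := by
  funext i
  fin_cases i
  · simp [toBrick]; ring
  · simp [toBrick]

/-- `toBrick` respects subtraction. [cite: Grimmett2018, §5.5] -/
theorem toBrick_sub (x y : Site 2) : toBrick (x - y) = toBrick x - toBrick y := by
  funext i
  fin_cases i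
  · simp [toBrick]; ring
  · simp [toBrick]

/-- `toBrick` is injective. [cite: Grimmett2018, §5.5] -/
theorem toBrick_injective : Function.Injective toBrick := by
  intro x y h
  have h0 := congrFun h 0
  have h1 := congrFun h 1
  simp only [toBrick_apply_zero, toBrick_apply_one] at h0 h1
  funext i
  fin_cases i
  · show x 0 = y 0
    omega
  · exact h1

/-- **Adjacency of `𝕋` in brick coordinates** (the tree's `triGraph_adj_iff_brick`, restated):
`toBrick x ~ toBrick y` in the brick-wall graph iff `x ~ y` in `𝕋`. [cite: Grimmett2018, §5.5] -/
theorem brickGraph_adj_toBrick (x y : Site 2) : brickGraph.Adj (toBrick x) (toBrick y) ↔ triGraph.Adj x y := by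
  rw [triGraph_adj_iff_brick, brickGraph_adj_iff]
  simp only [toBrick_apply_zero, toBrick_apply_one, brickX]

/-- The inverse chart `(X, Y) ↦ ((X − Y)/2, Y)` (a left inverse of `toBrick`; a right inverse on the
sublattice `X ≡ Y (mod 2)`). [cite: Grimmett2018, §5.5] -/
def fromBrick (u : Site 2) : Site 2 := fun i => if i = 0 then (u 0 - u 1) / 2 else u 1

/-- `fromBrick ∘ toBrick = id`. [cite: Grimmett2018, §5.5] -/
@[simp] theorem fromBrick_toBrick (x : Site 2) : fromBrick (toBrick x) = x := by
  funext i
  fin_cases i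
  · show (2 * x 0 + x 1 - x 1) / 2 = x 0
    omega
  · rfl

/-- `toBrick ∘ fromBrick = id` on the sublattice `X + Y` even. [cite: Grimmett2018, §5.5] -/
theorem toBrick_fromBrick {u : Site 2} (hu : Even (u 0 + u 1)) : toBrick (fromBrick u) = u := by
  obtain ⟨k, hk⟩ := hu
  funext i
  fin_cases i
  · show 2 * ((u 0 - u 1) / 2) + u 1 = u 0
    omega
  · rfl

/-! ### The vertex-function model of the walks of `𝕋` in brick coordinates -/

/-- A vertex list of `𝕋` read in brick coordinates as a vertex function frozen after time `n`.
[cite: MadrasSlade1993, §1.1] -/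
def brickFun (n : ℕ) (l : List (Site 2)) : ℕ → Site 2 := fun i => toBrick (l.getD (min i n) 0)

/-- Values of `brickFun`. [cite: MadrasSlade1993, §1.1] -/
theorem brickFun_apply (n : ℕ) (l : List (Site 2)) (i : ℕ) :
    brickFun n l i = toBrick (l.getD (min i n) 0) := rfl

open Classical in
/-- **The `n`-step self-avoiding walks of `𝕋` from `0`, in brick coordinates, as vertex functions**
`ℕ → ℤ²` frozen after time `n` (the image of the list model `triSL n`). [cite: MadrasSlade1993, §1.1] -/
def brickSaws (n : ℕ) : Finset (ℕ → Site 2) := (triSL n).image (brickFun n)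

/-- `brickFun n` is injective on `S_n(𝕋)`. [cite: MadrasSlade1993, §1.1] -/
theorem brickFun_injOn (n : ℕ) : Set.InjOn (brickFun n) ↑(triSL n) := by
  intro l hl l' hl' h
  rw [Finset.mem_coe] at hl hl'
  have hlen := length_of_mem_triSL hl
  have hlen' := length_of_mem_triSL hl'
  refine List.ext_getElem (by rw [hlen, hlen']) fun i hi hi' => ?_
  have := congrFun h i
  rw [brickFun_apply, brickFun_apply, min_eq_left (by omega : i ≤ n)] at this
  have e := toBrick_injective this
  rwa [← List.getElem_eq_getD (h := hi), ← List.getElem_eq_getD (h := hi')] at e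

/-- **`#(brickSaws n) = c_n(𝕋)`**. [cite: MadrasSlade1993, §1.1] -/
theorem card_brickSaws (n : ℕ) : #(brickSaws n) = triSawCount n := by
  classical
  rw [brickSaws, Finset.card_image_of_injOn (brickFun_injOn n), card_triSL]

/-- The parity invariant: a vertex function from `0` with `brickGraph` steps stays on the sublattice
`X + Y` even. [cite: Grimmett2018, §5.5] -/
theorem even_add_of_steps {ω : ℕ → Site 2} {n : ℕ} (h0 : ω 0 = 0)
    (hadj : ∀ i < n, brickGraph.Adj (ω i) (ω (i + 1))) : ∀ i ≤ n, Even (ω i 0 + ω i 1) := by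
  intro i
  induction i with
  | zero => intro _; simp [h0]
  | succ i ih =>
    intro hi
    exact (even_add_iff_of_adj (hadj i (by omega))).1 (ih (by omega))

/-- After `i` steps the height is at most `2i` in absolute value. [cite: MadrasSlade1993, §1.1] -/
theorem abs_apply_zero_le_of_steps {ω : ℕ → Site 2} {n : ℕ} (h0 : ω 0 = 0)
    (hadj : ∀ i < n, brickGraph.Adj (ω i) (ω (i + 1))) : ∀ i ≤ n, |ω i 0| ≤ 2 * (i : ℤ) := by
  intro i
  induction i with
  | zero => intro _; simp [h0]
  | succ i ih =>
    intro hi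
    have h1 := abs_sub_apply_zero_le_two (hadj i (by omega))
    have h2 := ih (by omega)
    calc |ω (i + 1) 0| = |(ω (i + 1) 0 - ω i 0) + ω i 0| := by ring_nf
      _ ≤ |ω (i + 1) 0 - ω i 0| + |ω i 0| := abs_add_le _ _
      _ ≤ 2 * (((i + 1 : ℕ)) : ℤ) := by push_cast; linarith

/-- **Membership in `brickSaws`** (the analogue of `Zd.mem_saws`): `ω` starts at `0`, makes `n` steps of
the brick-wall graph, is frozen from time `n` on, and visits no site twice during `[0, n]`.
[cite: MadrasSlade1993, §1.1] -/
theorem mem_brickSaws {n : ℕ} {ω : ℕ → Site 2} :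
    ω ∈ brickSaws n ↔ ω 0 = 0 ∧ (∀ i, n ≤ i → ω i = ω n) ∧
      (∀ i < n, brickGraph.Adj (ω i) (ω (i + 1))) ∧ Set.InjOn ω {i | i ≤ n} := by
  classical
  constructor
  · intro h
    rw [brickSaws, Finset.mem_image] at h
    obtain ⟨l, hl, rfl⟩ := h
    have hlen := length_of_mem_triSL hl
    refine ⟨?_, ?_, ?_, ?_⟩
    · rw [brickFun_apply, Nat.zero_min, getD_zero_of_mem_triSL hl, toBrick_zero]
    · intro i hi
      rw [brickFun_apply, brickFun_apply, min_eq_right hi, min_self]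
    · intro i hi
      rw [brickFun_apply, brickFun_apply, min_eq_left hi.le, min_eq_left (by omega : i + 1 ≤ n),
        brickGraph_adj_toBrick]
      exact adj_getD_of_mem_triSL hl (by omega)
    · intro i hi j hj hij
      simp only [Set.mem_setOf_eq] at hi hj
      rw [brickFun_apply, brickFun_apply, min_eq_left hi, min_eq_left hj] at hij
      exact getD_injOn_of_mem_triSL hl (by omega) (by omega) (toBrick_injective hij)
  · rintro ⟨h0, hend, hadj, hinj⟩
    have hev := even_add_of_steps h0 hadj
    -- the list of preimages
    set l : List (Site 2) := (List.range (n + 1)).map fun i => fromBrick (ω i) with hl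
    have hlen : l.length = n + 1 := by simp [hl]
    have hget : ∀ i, i ≤ n → l.getD i 0 = fromBrick (ω i) := by
      intro i hi
      rw [hl, List.getD_eq_getElem _ _ (by simp; omega)]
      simp
    have hmem : l ∈ triSL n := by
      refine mem_triSL_of hlen ?_ ?_ ?_
      · rw [hget 0 (Nat.zero_le n), h0]
        funext i; fin_cases i <;> rfl
      · intro i hi
        rw [hget i (by omega), hget (i + 1) (by omega), ← brickGraph_adj_toBrick,
          toBrick_fromBrick (hev i (by omega)), toBrick_fromBrick (hev (i + 1) (by omega))]
        exact hadj i (by omega)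
      · rw [hl]
        refine List.Nodup.map_on (fun i hi j hj hij => ?_) List.nodup_range
        rw [List.mem_range] at hi hj
        have e := congrArg toBrick hij
        rw [toBrick_fromBrick (hev i (by omega)), toBrick_fromBrick (hev j (by omega))] at e
        exact hinj (show i ≤ n by omega) (show j ≤ n by omega) e
    rw [brickSaws, Finset.mem_image]
    refine ⟨l, hmem, funext fun i => ?_⟩
    rw [brickFun_apply, hget _ (Nat.min_le_right i n), toBrick_fromBrick (hev _ (Nat.min_le_right i n))]
    rcases le_or_gt i n with hi | hi
    · rw [min_eq_left hi]
    · rw [min_eq_right hi.le, hend i hi.le]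

/-- A walk of `brickSaws n` has height at most `2i` in absolute value at time `i ≤ n`.
[cite: MadrasSlade1993, §1.1] -/
theorem abs_apply_zero_le_of_mem_brickSaws {n : ℕ} {ω : ℕ → Site 2} (hω : ω ∈ brickSaws n) :
    ∀ i ≤ n, |ω i 0| ≤ 2 * (i : ℤ) := by
  obtain ⟨h0, -, hadj, -⟩ := mem_brickSaws.1 hω
  exact abs_apply_zero_le_of_steps h0 hadj

end Literature.Probability.RandomPlanarGeometry.SAW
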